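import Summits.ValiantsHypothesis.ValiantsHypothesis.Theorems.LacunarySymmetroidMatrixDescartesCensusV19GSoundCerts
import Summits.ValiantsHypothesis.ValiantsHypothesis.Theorems.LacunarySymmetroidMatrixDescartesCensusV19SSoundNineteen
import Summits.ValiantsHypothesis.ValiantsHypothesis.Theorems.LacunarySymmetroidMatrixDescartesCensusGeneralWindow
import Summits.ValiantsHypothesis.ValiantsHypothesis.Theorems.LacunarySymmetroidMatrixDescartesCensusNineteenFlank

/-!
# `MatrixDescartes` census — soundness of the `V19G` checker: a nineteen yields a `V19G` model; the support theorems

HONEST FRAMING.  Object-search cell `pub-symmetroid`; door-A item `DoorA26 = PosRootLawAt 2 6 19` (stmt-ValiantsHypothesis-19979; OPEN, typed,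
never asserted) and its sharper support rows `PosRootLawOn 2 6 18 d`.  PROOFS, no new definitions.  (1) A pencil with `19` distinct positive det-roots
on a 2-Sidon support (given the `V = 20` row of the support) yields a `V19G.Model` of the cell it realises (`model_of_nineteen`): the `V19S` part is
door-p4 g5's `V19S.modelA_of_nineteen` / `modelB_of_nineteen` (unchanged); the GENERAL WINDOW BALANCES of mode `A` come from val-sym-door-p5 g5's
`Census.window4_balance_support` (…CensusGeneralWindow) at the four sums `E_a < E_b < E_e < E_f` — the twisted coefficient `c_t · ∏_{u ∉ W}(E_t − u)`
is `twistSgnR_t · x_t · P_t` by the cell's sign pattern (`V19S.signA`), the signed-weight bookkeeping `Census.prod_ite4_sub_eq_negOnePow_mul_natCast`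
and `V19S.prod_ite4_eq_redW` (`twist_term_eq`).  (2) Hence (`posRootLawOn_of_certs`, `posRootLawOn_of_slices8`, the shape of `V19S`'s): if every
well-formed cell of a support carries a certificate accepted by `V19G.checkCells` and the support has no twenty, it has no nineteen — `ζ(2,6; d) ≤ 18`.
Nothing here bears on the one-collision supports, on `ζ_sym(2,6)` over all supports, on `MatrixDescartes` (stmt-ValiantsHypothesis-18050) or on `VP ≠ VNP`.

[folklore] Certificate-checker soundness; elementary.
-/

-- the D-0017 layout repeats a namespace component (single-conjunct summit); the `dupNamespace` linter flags it; name mandated.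
set_option linter.dupNamespace false

namespace Summit.ValiantsHypothesis.ValiantsHypothesis.Theorems.LacunarySymmetroidMatrixDescartes.Census.V19G

open Polynomial
open V20 (Atom allAtoms sortAtoms ordOK sums Epos fval pdet dfun aval sums_getD Epos_lt sums_nodup)
open V19S (Ctx Mode mkCtx negSlot redW sgR_A ite_pm_cases eq_sgn_mul_abs Epos_mem_supportA card_supportA supportA_eq signA
  prod_ite4_eq_redW exists_repetition sliceA sliceB mem_sliceA mem_sliceB)

/-! ### Case A: the general window balances of a nineteen -/

section CaseA

variable {dl : List ℕ} {ord : List Atom} {S : Fin 6 → Matrix (Fin 2) (Fin 2) ℝ}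

/-- The checker's `aboveOut` over a duplicate-free list is the cardinality of the corresponding filter of its `toFinset`. [folklore] -/
theorem aboveOut_eq_card (L : List ℕ) (hL : L.Nodup) (a b e f t : ℕ) :
    aboveOut L [a, b, e, f] t = (L.toFinset.filter (fun u => ¬ (u = a ∨ u = b ∨ u = e ∨ u = f) ∧ t < u)).card := by
  classical
  unfold aboveOut
  rw [← List.toFinset_card_of_nodup (hL.filter _), List.toFinset_filter]
  congr 1
  ext u
  simp only [Finset.mem_filter, List.mem_toFinset, Bool.and_eq_true, decide_eq_true_eq, Bool.not_eq_true',
    decide_eq_false_iff_not, List.mem_cons, List.not_mem_nil, or_false]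
  tauto

/-- `(−1)^m` as the checker's parity test. [folklore] -/
theorem neg_one_pow_eq_ite (m : ℕ) : (-1 : ℝ) ^ m = if (m % 2 == 1) = true then -1 else 1 := by
  rcases Nat.even_or_odd m with hm | hm
  · rw [hm.neg_one_pow, if_neg]; rw [beq_iff_eq]; rw [Nat.even_iff] at hm; omega
  · rw [hm.neg_one_pow, if_pos]; rw [beq_iff_eq]; exact Nat.odd_iff.1 hm

/-- **The twisted window term of a Case-A nineteen in the checker's vocabulary.**  For the cell `(s, A k)` of a nineteen with all coefficients non-zero
(`s` = sign of the lowest coefficient, repetition at `(k, k+1)`), four positions `a, b, e, f < 21`, `t` one of them, and `y`: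
`c_{E_t} · (∏_{u ∈ supp, u ∉ W} (E_t − u)) · y^{E_t} = twistSgnR_t · gterm_t(y)` (window sums `W = [E_a, E_b, E_e, E_f]`). [folklore] -/
theorem twist_term_eq (h : ordOK dl ord = true) (hall : ∀ t, t < 21 → (pdet dl S).coeff (Epos dl ord t) ≠ 0) {k : ℕ}
    (hrep : 0 < (pdet dl S).coeff (Epos dl ord k) * (pdet dl S).coeff (Epos dl ord (k + 1)))
    (halt : ∀ t, t + 1 < 21 → t ≠ k → (pdet dl S).coeff (Epos dl ord t) * (pdet dl S).coeff (Epos dl ord (t + 1)) < 0)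
    (x : ℕ → ℝ) (hx : ∀ t, t < 21 → x t = |(pdet dl S).coeff (Epos dl ord t)|)
    {a b e f : ℕ} (ha : a < 21) (hb : b < 21) (he : e < 21) (hf : f < 21) {t : ℕ} (ht : t = a ∨ t = b ∨ t = e ∨ t = f) (y : ℝ) :
    let c := mkCtx dl ord (decide (0 < (pdet dl S).coeff (Epos dl ord 0))) (.A k) none
    (pdet dl S).coeff (Epos dl ord t) *
        (∏ u ∈ (pdet dl S).support, (if u = Epos dl ord a ∨ u = Epos dl ord b ∨ u = Epos dl ord e ∨ u = Epos dl ord f then (1 : ℝ)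
          else ((Epos dl ord t : ℝ) - u))) * y ^ (Epos dl ord t)
      = twistSgnR c (wsums c.E [a, b, e, f]) t * gterm c x (wsums c.E [a, b, e, f]) t y := by
  intro c
  have ht21 : t < 21 := by rcases ht with rfl | rfl | rfl | rfl <;> assumption
  have hE : c.E = sums dl ord := rfl
  have hWs : wsums c.E [a, b, e, f] = [Epos dl ord a, Epos dl ord b, Epos dl ord e, Epos dl ord f] := by
    simp only [wsums, List.map_cons, List.map_nil, hE, sums_getD h ha, sums_getD h hb, sums_getD h he, sums_getD h hf]
  have hEt : c.E.getD t 0 = Epos dl ord t := by rw [hE, sums_getD h ht21]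
  -- the coefficient: sign times modulus
  have hsg := signA (dl := dl) (ord := ord) (S := S) hall hrep halt t ht21
  have hcoef : (pdet dl S).coeff (Epos dl ord t) = V19S.sgR c t * x t := by
    rw [hx t ht21]; exact eq_sgn_mul_abs (by rw [sgR_A]; exact ite_pm_cases _) hsg
  -- the signed reduced weight: parity sign times the checker's reduced weight
  have hprod := prod_ite4_sub_eq_negOnePow_mul_natCast (pdet dl S).support (Epos dl ord t)
    (Epos dl ord a) (Epos dl ord b) (Epos dl ord e) (Epos dl ord f)
  have habs := prod_ite4_abs_sub_eq_natCast (pdet dl S).support (Epos dl ord t)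
    (Epos dl ord a) (Epos dl ord b) (Epos dl ord e) (Epos dl ord f)
  have hred : (∏ u ∈ (pdet dl S).support, (if u = Epos dl ord a ∨ u = Epos dl ord b ∨ u = Epos dl ord e ∨ u = Epos dl ord f then (1 : ℝ)
      else |((Epos dl ord t : ℕ) : ℝ) - (u : ℝ)|)) = gredWR c (wsums c.E [a, b, e, f]) t := by
    unfold gredWR
    rw [hWs, hEt, hE, supportA_eq h hall, prod_ite4_eq_redW _ (sums_nodup h) _ _ _ _ _ (by
      rcases ht with rfl | rfl | rfl | rfl <;> simp)]
  have hcard : ((pdet dl S).support.filter (fun u => ¬ (u = Epos dl ord a ∨ u = Epos dl ord b ∨ u = Epos dl ord e ∨ u = Epos dl ord f) ∧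
      Epos dl ord t < u)).card = aboveOut c.E (wsums c.E [a, b, e, f]) (c.E.getD t 0) := by
    rw [hWs, hEt, hE, supportA_eq h hall, aboveOut_eq_card _ (sums_nodup h)]
  have hsign : V19S.sgR c t * (-1 : ℝ) ^ ((pdet dl S).support.filter (fun u => ¬ (u = Epos dl ord a ∨ u = Epos dl ord b ∨
      u = Epos dl ord e ∨ u = Epos dl ord f) ∧ Epos dl ord t < u)).card = twistSgnR c (wsums c.E [a, b, e, f]) t := by
    rw [hcard, neg_one_pow_eq_ite, sgR_A]
    unfold twistSgnR twistNeg
    simp only [c, mkCtx]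
    cases negSlot (decide (0 < (pdet dl S).coeff (Epos dl ord 0))) (Mode.A k) t <;>
      cases (aboveOut (sums dl ord) (wsums (sums dl ord) [a, b, e, f]) ((sums dl ord).getD t 0) % 2 == 1) <;> simp
  rw [hprod, ← habs, hred, hcoef]
  unfold gterm
  rw [hEt, ← hsign]
  ring

/-- **A Case-A nineteen yields a `V19G` model** of the cell `(s, A k)`, `s` = sign of the lowest coefficient, branch `none`: the `V19S` model of
door-p4 g5 plus the general window balances (`Census.window4_balance_support`). [folklore] -/
theorem modelA_of_nineteen (h : ordOK dl ord = true) (hS : ∀ l, (S l).IsSymm)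
    (h19 : 19 ≤ ((pdet dl S).roots.toFinset.filter (fun t => 0 < t)).card)
    (hall : ∀ t, t < 21 → (pdet dl S).coeff (Epos dl ord t) ≠ 0) {k : ℕ} (hk : k < 20)
    (hrep : 0 < (pdet dl S).coeff (Epos dl ord k) * (pdet dl S).coeff (Epos dl ord (k + 1)))
    (halt : ∀ t, t + 1 < 21 → t ≠ k → (pdet dl S).coeff (Epos dl ord t) * (pdet dl S).coeff (Epos dl ord (t + 1)) < 0) :
    V19G.Model (mkCtx dl ord (decide (0 < (pdet dl S).coeff (Epos dl ord 0))) (.A k) none)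
      (fun p => if p < 21 then |(pdet dl S).coeff (Epos dl ord p)| else 1) (aval S) := by
  refine ⟨V19S.modelA_of_nineteen h hS h19 hall hk hrep halt, ?_⟩
  intro k' a b e f hk' hab hbe hef hf
  have ha : a < 21 := by omega
  have hb : b < 21 := by omega
  have he : e < 21 := by omega
  have hZ3 : (pdet dl S).support.card ≤ ((pdet dl S).roots.toFinset.filter (fun t => 0 < t)).card + 3 := by
    rw [card_supportA h hall]; omega
  have hx : ∀ t, t < 21 → (fun p => if p < 21 then |(pdet dl S).coeff (Epos dl ord p)| else 1) t = |(pdet dl S).coeff (Epos dl ord t)| := by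
    intro t ht; simp only; rw [if_pos ht]
  obtain ⟨y, hy, hbal⟩ := window4_balance_support (pdet dl S) hZ3
    (Epos_mem_supportA hall ha) (Epos_mem_supportA hall hb) (Epos_mem_supportA hall he) (Epos_mem_supportA hall hf)
    (Epos_lt h hab hb) (Epos_lt h hbe he) (Epos_lt h hef hf)
  refine ⟨y, hy, ?_⟩
  have T := fun (t : ℕ) (ht : t = a ∨ t = b ∨ t = e ∨ t = f) =>
    twist_term_eq h hall hrep halt _ hx ha hb he hf ht y
  rw [← T a (Or.inl rfl), ← T b (Or.inr (Or.inl rfl)), ← T e (Or.inr (Or.inr (Or.inl rfl))), ← T f (Or.inr (Or.inr (Or.inr rfl)))]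
  exact hbal

/-- **A nineteen yields a `V19G` model** (given the `V = 20` row of its support): Case B at a vanishing coefficient (the general balances are vacuous
outside mode `A`), else Case A at its unique repetition. [folklore] -/
theorem model_of_nineteen (h : ordOK dl ord = true) (hS : ∀ l, (S l).IsSymm)
    (h19 : 19 ≤ ((pdet dl S).roots.toFinset.filter (fun t => 0 < t)).card) (h20 : PosRootLawOn 2 6 19 (dfun dl)) :
    ∃ (s : Bool) (m : Mode) (x : ℕ → ℝ), m.ok = true ∧ V19G.Model (mkCtx dl ord s m none) x (aval S) := by
  by_cases hB : ∃ z, z < 21 ∧ (pdet dl S).coeff (Epos dl ord z) = 0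
  · obtain ⟨z, hz, hcz⟩ := hB
    refine ⟨_, .B z, _, by simp only [Mode.ok, decide_eq_true_eq]; omega, V19S.modelB_of_nineteen h hS h19 hz hcz, ?_⟩
    intro k a b e f hk
    simp [mkCtx] at hk
  · push Not at hB
    obtain ⟨k, hk, hrep, halt⟩ := exists_repetition h hS h19 h20 hB
    exact ⟨_, .A k, _, by simp only [Mode.ok, decide_eq_true_eq]; omega, modelA_of_nineteen h hS h19 hB hk hrep halt⟩

end CaseA

/-! ### The main theorems -/

section Nineteen

/-- What `cellsOK` establishes: every listed cell carries an accepted certificate. [folklore] -/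
theorem cellsOK_spec (d : List ℕ) (ord : List Atom) :
    ∀ (L : List (Bool × Mode)) (cs : List V19G.Cert), V19G.cellsOK d ord L cs = true →
      ∀ (s : Bool) (m : Mode), (s, m) ∈ L → ∃ ct, V19G.certOK (mkCtx d ord s m none) ct = true
  | [], _, _, s, m, hsm => by simp at hsm
  | (s', m') :: L, [], h, _, _, _ => by simp [cellsOK] at h
  | (s', m') :: L, ct :: cs, h, s, m, hsm => by
    simp only [cellsOK, Bool.and_eq_true] at h
    rcases List.mem_cons.1 hsm with he | hsm
    · simp only [Prod.mk.injEq] at he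
      obtain ⟨rfl, rfl⟩ := he
      exact ⟨ct, h.1.2⟩
    · exact cellsOK_spec d ord L cs h.2 s m hsm

/-- What `checkCells` establishes: the order passed, and every listed cell carries an accepted certificate. [folklore] -/
theorem checkCells_spec {dl : List ℕ} {L : List (Bool × Mode)} {cs : List V19G.Cert} (h : V19G.checkCells dl L cs = true) :
    ordOK dl (sortAtoms dl) = true ∧ ∀ (s : Bool) (m : Mode), (s, m) ∈ L → ∃ ct, V19G.certOK (mkCtx dl (sortAtoms dl) s m none) ct = true := by
  unfold checkCells at h
  simp only [Bool.and_eq_true] at h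
  exact ⟨h.1, cellsOK_spec dl (sortAtoms dl) L cs h.2⟩

/-- **Soundness of the `V19G` checker**: if every well-formed cell of a support passing `V20.ordOK` carries an accepted certificate, and the support
has no twenty, then it has no nineteen — `ζ(2,6; d) ≤ 18`. [folklore] -/
theorem posRootLawOn_of_certs (dl : List ℕ) (hord : ordOK dl (sortAtoms dl) = true)
    (hall : ∀ (s : Bool) (m : Mode), m.ok = true → ∃ ct, V19G.certOK (mkCtx dl (sortAtoms dl) s m none) ct = true)
    (h20 : PosRootLawOn 2 6 19 (fun i => dl.getD i 0)) : PosRootLawOn 2 6 18 (fun i => dl.getD i 0) := by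
  intro S hS
  by_contra hlt
  have h19 : 19 ≤ ((pdet dl S).roots.toFinset.filter (fun t => 0 < t)).card := by
    unfold pdet dfun; push Not at hlt; exact hlt
  obtain ⟨s, m, x, hm, M⟩ := model_of_nineteen hord hS h19 h20
  obtain ⟨ct, hct⟩ := hall s m hm
  exact certOK_sound M hct

/-- **Soundness, eight-slice form** (the shape of the data files): the `82` cells of a support split as Case A `k < 10` / `10 ≤ k < 20` and Case B
`z < 11` / `11 ≤ z ≤ 20` in both orientations; if each slice passes `V19G.checkCells` and the support has no twenty, it has no nineteen. [folklore] -/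
theorem posRootLawOn_of_slices8 {dl : List ℕ} {c1 c2 c3 c4 c5 c6 c7 c8 : List V19G.Cert}
    (h1 : V19G.checkCells dl (sliceA true 0 10) c1 = true) (h2 : V19G.checkCells dl (sliceA true 10 20) c2 = true)
    (h3 : V19G.checkCells dl (sliceA false 0 10) c3 = true) (h4 : V19G.checkCells dl (sliceA false 10 20) c4 = true)
    (h5 : V19G.checkCells dl (sliceB true 0 11) c5 = true) (h6 : V19G.checkCells dl (sliceB true 11 21) c6 = true)
    (h7 : V19G.checkCells dl (sliceB false 0 11) c7 = true) (h8 : V19G.checkCells dl (sliceB false 11 21) c8 = true)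
    (h20 : PosRootLawOn 2 6 19 (fun i => dl.getD i 0)) : PosRootLawOn 2 6 18 (fun i => dl.getD i 0) := by
  obtain ⟨hord, H1⟩ := checkCells_spec h1
  obtain ⟨-, H2⟩ := checkCells_spec h2
  obtain ⟨-, H3⟩ := checkCells_spec h3
  obtain ⟨-, H4⟩ := checkCells_spec h4
  obtain ⟨-, H5⟩ := checkCells_spec h5
  obtain ⟨-, H6⟩ := checkCells_spec h6
  obtain ⟨-, H7⟩ := checkCells_spec h7
  obtain ⟨-, H8⟩ := checkCells_spec h8
  refine posRootLawOn_of_certs dl hord (fun s m hm => ?_) h20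
  cases m with
  | A k =>
    have hk : k < 20 := by simpa [Mode.ok] using hm
    cases s with
    | false =>
      by_cases hk10 : k < 10
      · exact H3 false (.A k) (mem_sliceA false (Nat.zero_le k) hk10)
      · exact H4 false (.A k) (mem_sliceA false (not_lt.1 hk10) hk)
    | true =>
      by_cases hk10 : k < 10
      · exact H1 true (.A k) (mem_sliceA true (Nat.zero_le k) hk10)
      · exact H2 true (.A k) (mem_sliceA true (not_lt.1 hk10) hk)
  | B z =>
    have hz : z ≤ 20 := by simpa [Mode.ok] using hm
    cases s with
    | false =>
      by_cases hz11 : z < 11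
      · exact H7 false (.B z) (mem_sliceB false (Nat.zero_le z) hz11)
      · exact H8 false (.B z) (mem_sliceB false (not_lt.1 hz11) (by omega))
    | true =>
      by_cases hz11 : z < 11
      · exact H5 true (.B z) (mem_sliceB true (Nat.zero_le z) hz11)
      · exact H6 true (.B z) (mem_sliceB true (not_lt.1 hz11) (by omega))

end Nineteen

end Summit.ValiantsHypothesis.ValiantsHypothesis.Theorems.LacunarySymmetroidMatrixDescartes.Census.V19G
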